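import Literature.Analysis.Pluripotential.NonPluripolarMongeAmpereMass
import Literature.Analysis.Pluripotential.LeviForm
import Literature.Analysis.Pluripotential.SubharmonicMaxPrinciple
import HarnessLib

/-!
# The Levi form and the Monge–Ampère density on the regular locus of a closed positive
# `(1,1)`-current on `ℙᴺ`

Topic `Literature/Analysis/Pluripotential`. Instalment towards the named fact
`GuedjZeriahi2007_lelongNumber_eq_zero_of_regularMass_eq` of `NonPluripolarMongeAmpereMass.lean`
("full regular Monge–Ampère mass ⟹ zero Lelong numbers", Guedj–Zeriahi 2007, Cor. 1.8): the
pointwise positivity of the Monge–Ampère density `heightDensity N g` on the regular locus `Reg(T)`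
of a `ClosedPositiveOneOneCurrent`, obtained by feeding the plurisubharmonicity of the cone potential
into the smooth-case positivity of the Levi form of `LeviForm.lean`
(`levi_nonneg_of_frequently_le_circleAverage`, `posSemidef_leviMatrix`). Everything is PROVED
(no definitions, no named facts).

## Main results

* `posSemidef_leviMatrix_of_contDiffAt` — packaging of `LeviForm.lean`: a function `C²` at `w` with
  the sub-mean-value inequality along every complex line through `w` (on arbitrarily small circles)
  has positive semidefinite `leviMatrix` (Hörmander §2.6, smooth case).
* `heightDensity_self_eq` — `heightDensity n G = n! (2/π)ⁿ Re det(leviMatrix G)`, the density of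
  `(dd^c G)ⁿ` (`Polynomial.coeff_det_X_add_C_card`); `heightDensity_self_nonneg_of_posSemidef`.
* For `T : ClosedPositiveOneOneCurrent N` with cone potential `V` and chart potential
  `g = (V ∘ chartVec).toReal`:
  `pot_chartVec_ne_bot_of_continuousAt` — **poles are not points of continuity of `g`** (upper
  semicontinuity of `V` at a pole forces `g < -1` at the non-poles nearby while `g = 0` at poles
  (junk value), so all nearby chart points would be poles and, by log-homogeneity, `V ≡ -∞` on a
  neighbourhood in `ℂ^{N+1}`, contradicting `frequently_ne_bot`); hence near a regular point
  `V(1, ·) = g` is finite (`eventually_pot_chartVec_eq_coe`) and satisfies the sub-mean-value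
  inequality along complex lines (`eventually_chartPotential_le_circleAverage`, read off the line
  `(1, w) + ℂ (0, ξ)` through `circleMean_coe_eq_circleAverage`); therefore
  `posSemidef_leviMatrix_chartPotential` (**`dd^c g ≥ 0` pointwise on `Reg(T)`**) and
  `heightDensity_chartPotential_nonneg` (**the integrand of `regularMass N` is `≥ 0` on
  `Reg(T)`**, as asserted in the docstring of `regularMass`).
* `lelongNumber_eq_zero_of_dim_zero` — on `ℙ⁰(ℂ)` all Lelong numbers vanish (the potential is
  `V(a) = V(v) + c log|a₀/v₀|`, finite and continuous); `lelongNumber_eq_zero_of_regularMass_eq_dim_zero`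
  is the (trivial) case `N = 0` of the Guedj–Zeriahi fact.
* Lelong-number bookkeeping for the contrapositive of the fact: `mem_lelongSlopes_of_le` (admissible
  slopes are downward closed), `exists_pos_mem_lelongSlopes` (a non-zero Lelong number is witnessed by
  a positive admissible slope, by the conventions of `Real.sSup`), `norm_chartVec_sub` (the chart is
  isometric for the sup norms), `tendsto_chartVec_nhdsNE`, and `eventually_pot_chartVec_le_log`
  (**an admissible slope `γ` at `(1, w₀)` gives `V(1, w) ≤ γ log ‖w - w₀‖ + C` for `w ≠ w₀` near
  `w₀`**).

## References

* [HormanderSCV1973] L. Hörmander, An introduction to complex analysis in several variables (1973):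
  Def. 2.6.1, §2.6 (Levi form of psh functions).
* [GuedjZeriahi2007] V. Guedj, A. Zeriahi, J. Funct. Anal. 250 (2007), Cor. 1.8 (the target fact).
-/

noncomputable section

open scoped Topology ComplexOrder LinearAlgebra.Projectivization
open MeasureTheory Filter Set Metric

namespace Literature.Analysis.Pluripotential

section Levi

open Complex
open Literature.AlgebraicGeometry.HodgeTheory.BiextensionHeight (leviMatrix heightDensity fsPotential)

variable {n : ℕ}

/-- The top height density is the Monge–Ampère density:
`heightDensity n G = n! (2/π)ⁿ Re det (leviMatrix G)`. [folklore] -/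
theorem heightDensity_self_eq (G : (Fin n → ℂ) → ℝ) (w : Fin n → ℂ) :
    heightDensity n G w = (n.factorial : ℝ) * (2 / Real.pi) ^ n * ((leviMatrix G w).det).re := by
  have h := Polynomial.coeff_det_X_add_C_card (leviMatrix G w) (leviMatrix fsPotential w)
  rw [Fintype.card_fin] at h
  simp [heightDensity, Nat.choose_self, h]

/-- A positive semidefinite Levi matrix gives a non-negative Monge–Ampère density
`heightDensity n G w = n! (2/π)ⁿ det(∂∂̄G) ≥ 0`. [folklore] -/
theorem heightDensity_self_nonneg_of_posSemidef {G : (Fin n → ℂ) → ℝ} {w : Fin n → ℂ}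
    (h : (leviMatrix G w).PosSemidef) : 0 ≤ heightDensity n G w := by
  rw [heightDensity_self_eq]
  have hre : 0 ≤ ((leviMatrix G w).det).re := by
    have := (Complex.le_def.1 h.det_nonneg).1
    simpa using this
  positivity

/-- For `G` of class `C²` at `w` the second derivative is symmetric. [folklore] -/
theorem fderiv_fderiv_symm_of_contDiffAt {G : (Fin n → ℂ) → ℝ} {w : Fin n → ℂ}
    (hG : ContDiffAt ℝ 2 G w) (a b : Fin n → ℂ) :
    fderiv ℝ (fderiv ℝ G) w a b = fderiv ℝ (fderiv ℝ G) w b a :=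
  hG.isSymmSndFDerivAt (by simp) a b

/-- **`C²` plurisubharmonic functions have positive semidefinite Levi form** (packaging of
`levi_nonneg_of_frequently_le_circleAverage` and `posSemidef_leviMatrix`): if `G : ℂⁿ → ℝ` is
`C²` at `w` and satisfies, along every complex line through `w`, the sub-mean-value inequality on
arbitrarily small circles, then `(∂²G/∂w_p∂w̄_q)(w) ≥ 0`.
[cite: HormanderSCV1973, Thm. 1.6.3 and §2.6 (Levi form of psh functions)] -/
theorem posSemidef_leviMatrix_of_contDiffAt {G : (Fin n → ℂ) → ℝ} {w : Fin n → ℂ}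
    (hG : ContDiffAt ℝ 2 G w)
    (hsub : ∀ ξ : Fin n → ℂ, ∃ᶠ r in 𝓝[>] (0 : ℝ),
      G w ≤ Real.circleAverage (fun τ : ℂ ↦ G (w + τ • ξ)) 0 r) :
    (leviMatrix G w).PosSemidef :=
  posSemidef_leviMatrix (fderiv_fderiv_symm_of_contDiffAt hG)
    fun ξ ↦ levi_nonneg_of_frequently_le_circleAverage hG ξ (hsub ξ)

end Levi

section LelongSlopes

variable {E : Type*} [NormedAddCommGroup E]

/-- Admissible Lelong slopes are downward closed in `[0, γ]` (near `a`, `log ‖z - a‖ ≤ 0`).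
[folklore] -/
theorem mem_lelongSlopes_of_le {u : E → EReal} {a : E} {γ γ' : ℝ} (hγ : γ ∈ lelongSlopes u a)
    (h0 : 0 ≤ γ') (hle : γ' ≤ γ) : γ' ∈ lelongSlopes u a := by
  obtain ⟨-, C, hC⟩ := hγ
  refine ⟨h0, C, ?_⟩
  have hball : ∀ᶠ z in 𝓝[≠] a, ‖z - a‖ < 1 := by
    have : Metric.ball a 1 ∈ 𝓝 a := Metric.ball_mem_nhds a one_pos
    filter_upwards [nhdsWithin_le_nhds this] with z hz
    rwa [Metric.mem_ball, dist_eq_norm] at hz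
  filter_upwards [hC, hball, self_mem_nhdsWithin] with z hz hz1 hza
  refine hz.trans ?_
  rw [EReal.coe_le_coe_iff]
  have hlog : Real.log ‖z - a‖ ≤ 0 := Real.log_nonpos (norm_nonneg _) hz1.le
  nlinarith

/-- A non-zero Lelong number is witnessed by a positive admissible slope (by the conventions of
`Real.sSup`, a non-zero supremum comes from a non-empty bounded set not reduced to `{0}`).
[folklore] -/
theorem exists_pos_mem_lelongSlopes {u : E → EReal} {a : E} (h : lelongNumber u a ≠ 0) :
    ∃ γ, 0 < γ ∧ γ ∈ lelongSlopes u a := by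
  rw [lelongNumber_eq_sSup] at h
  by_contra hne
  simp only [not_exists, not_and] at hne
  apply h
  have hS : lelongSlopes u a ⊆ {0} := fun γ hγ ↦ by
    rcases hγ.1.eq_or_lt with h0 | hpos
    · exact h0 ▸ rfl
    · exact absurd hγ (hne γ hpos)
  rcases (lelongSlopes u a).eq_empty_or_nonempty with he | hne'
  · rw [he, Real.sSup_empty]
  · rw [(hne'.subset_singleton_iff).1 hS, csSup_singleton]

end LelongSlopes

/-! ### The regular locus of a closed positive `(1,1)`-current on `ℙᴺ` -/

section Current

open Complex
open Literature.AlgebraicGeometry.HodgeTheory.BiextensionHeight (leviMatrix heightDensity chartVec)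

variable {N : ℕ}

/-- The affine chart is compatible with complex lines: `(1, w + τξ) = (1, w) + τ (0, ξ)`. [folklore] -/
theorem chartVec_add_smul (w ξ : Fin N → ℂ) (τ : ℂ) :
    chartVec (w + τ • ξ) = chartVec w + τ • Fin.insertNth 0 (0 : ℂ) ξ := by
  funext i
  refine Fin.cases ?_ (fun j ↦ ?_) i
  · simp [chartVec]
  · simp [chartVec]

/-- Points of the affine chart are non-zero vectors (`z₀ = 1`). [folklore] -/
theorem chartVec_ne_zero (w : Fin N → ℂ) : chartVec w ≠ 0 := fun h ↦ by
  have := congr_fun h 0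
  simp [chartVec] at this

/-- The sup norm of `(0, x) ∈ ℂ^{N+1}` is the sup norm of `x ∈ ℂᴺ`. [folklore] -/
theorem norm_insertNth_zero_zero (x : Fin N → ℂ) :
    ‖(Fin.insertNth (α := fun _ ↦ ℂ) 0 0 x)‖ = ‖x‖ := by
  apply le_antisymm
  · refine (pi_norm_le_iff_of_nonneg (norm_nonneg x)).2 fun i ↦ ?_
    refine Fin.cases ?_ (fun j ↦ ?_) i
    · simp
    · simpa using norm_le_pi_norm x j
  · refine (pi_norm_le_iff_of_nonneg (norm_nonneg _)).2 fun j ↦ ?_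
    have := norm_le_pi_norm (Fin.insertNth (α := fun _ ↦ ℂ) 0 0 x) j.succ
    simpa using this

/-- Differences of chart points: `(1, w) - (1, w₀) = (0, w - w₀)`, so the chart is an isometric
embedding for the sup norms. [folklore] -/
theorem norm_chartVec_sub (w w₀ : Fin N → ℂ) : ‖chartVec w - chartVec w₀‖ = ‖w - w₀‖ := by
  have h := chartVec_add_smul w₀ (w - w₀) 1
  rw [one_smul, one_smul, add_sub_cancel] at h
  rw [h, add_sub_cancel_left, norm_insertNth_zero_zero]

/-- The chart maps punctured neighbourhoods to punctured neighbourhoods. [folklore] -/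
theorem tendsto_chartVec_nhdsNE (w₀ : Fin N → ℂ) :
    Tendsto (chartVec : (Fin N → ℂ) → Fin (N + 1) → ℂ) (𝓝[≠] w₀) (𝓝[≠] (chartVec w₀)) := by
  refine tendsto_nhdsWithin_of_tendsto_nhds_of_eventually_within _
    ((ClosedPositiveOneOneCurrent.contDiff_chartVec (N := N)).continuous.continuousAt.mono_left
      nhdsWithin_le_nhds) ?_
  filter_upwards [self_mem_nhdsWithin] with w hw
  intro h
  apply hw
  have : ‖chartVec w - chartVec w₀‖ = 0 := by rw [mem_singleton_iff.1 h, sub_self, norm_zero]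
  rw [norm_chartVec_sub, norm_eq_zero, sub_eq_zero] at this
  exact this

/-- A non-zero vector with `z₀ ≠ 0` is `z₀ • (1, z'/z₀)`. [folklore] -/
theorem eq_smul_chartVec {z : Fin (N + 1) → ℂ} (hz : z 0 ≠ 0) :
    z = z 0 • chartVec (fun j ↦ z j.succ / z 0) := by
  funext i
  refine Fin.cases ?_ (fun j ↦ ?_) i
  · simp [chartVec]
  · simp [chartVec, mul_div_cancel₀ _ hz]

namespace ClosedPositiveOneOneCurrent

variable (T : ClosedPositiveOneOneCurrent N)

/-- **Poles are not regular points.** If the chart potential `g = (V ∘ chartVec).toReal` is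
continuous at `w`, then `(1, w)` is not a pole of `V`: otherwise upper semicontinuity of `V` forces
`g < -1` at the non-poles near `w` while `g(w) = 0` (junk value), so all points near `w` would be
poles, and by log-homogeneity `V ≡ -∞` on a neighbourhood of `(1, w)` in `ℂ^{N+1}`, contradicting
`frequently_ne_bot`. [folklore] -/
theorem pot_chartVec_ne_bot_of_continuousAt {w : Fin N → ℂ} (hc : ContinuousAt T.chartPotential w) :
    T.pot (chartVec w) ≠ ⊥ := by
  intro hbot
  -- `V < -1` near `(1, w)`
  have husc : ∀ᶠ z in 𝓝 (chartVec w), T.pot z < ((-1 : ℝ) : EReal) := by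
    have hmem : chartVec w ∈ ({0}ᶜ : Set (Fin (N + 1) → ℂ)) := chartVec_ne_zero w
    have h := T.isPlurisubharmonicOn_pot.upperSemicontinuousOn (chartVec w) hmem ((-1 : ℝ) : EReal)
      (by beta_reduce; rw [hbot]; exact EReal.bot_lt_coe _)
    rwa [isOpen_compl_singleton.nhdsWithin_eq hmem] at h
  -- all chart points near `w` are poles
  have hpole : ∀ᶠ w' in 𝓝 w, T.pot (chartVec w') = ⊥ := by
    have h1 : ∀ᶠ w' in 𝓝 w, T.pot (chartVec w') < ((-1 : ℝ) : EReal) :=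
      (contDiff_chartVec (N := N)).continuous.continuousAt.eventually husc
    have h2 : ∀ᶠ w' in 𝓝 w, dist (T.chartPotential w') (T.chartPotential w) < 2⁻¹ :=
      hc.eventually (Metric.ball_mem_nhds _ (by norm_num))
    filter_upwards [h1, h2] with w' hw1 hw2
    by_contra hne
    have hcoe : ((T.chartPotential w' : ℝ) : EReal) = T.pot (chartVec w') :=
      EReal.coe_toReal (T.pot_lt_top (chartVec_ne_zero w')).ne hne
    rw [← hcoe, EReal.coe_lt_coe_iff] at hw1
    have h0 : T.chartPotential w = 0 := by simp [chartPotential, hbot]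
    rw [h0, Real.dist_eq, sub_zero] at hw2
    have := (abs_lt.1 hw2).1
    linarith
  -- hence `V ≡ -∞` near `(1, w)`
  have hcont : ContinuousAt (fun z : Fin (N + 1) → ℂ ↦ fun j : Fin N ↦ z j.succ / z 0) (chartVec w) := by
    refine continuousAt_pi.2 fun j ↦ ?_
    have h0 : (chartVec w) 0 ≠ 0 := by simp [chartVec]
    exact ((continuous_apply j.succ).continuousAt).div ((continuous_apply 0).continuousAt) h0
  have hlim : Tendsto (fun z : Fin (N + 1) → ℂ ↦ fun j : Fin N ↦ z j.succ / z 0) (𝓝 (chartVec w))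
      (𝓝 w) := by
    have hval : (fun j : Fin N ↦ (chartVec w) j.succ / (chartVec w) 0) = w := by
      funext j; simp [chartVec]
    simpa [hval] using hcont.tendsto
  have hz0 : ∀ᶠ z in 𝓝 (chartVec w), z 0 ≠ 0 := by
    have : (chartVec w) 0 ≠ 0 := by simp [chartVec]
    exact (continuous_apply 0).continuousAt.eventually_ne this
  have hall : ∀ᶠ z in 𝓝 (chartVec w), T.pot z = ⊥ := by
    filter_upwards [hz0, hlim.eventually hpole] with z hz hzp
    rw [eq_smul_chartVec hz, T.pot_smul hz (chartVec_ne_zero _), hzp, EReal.bot_add]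
  exact T.frequently_ne_bot (chartVec w) (chartVec_ne_zero w) (hall.mono fun z hz ↦ not_ne_iff.mpr hz)

/-- On a neighbourhood of a regular point the cone potential along the chart is the real chart
potential: `V(1, w') = g(w')` (finite) for `w'` near `w ∈ Reg(T)`. [folklore] -/
theorem eventually_pot_chartVec_eq_coe {w : Fin N → ℂ} (hw : w ∈ T.regularLocus) :
    ∀ᶠ w' in 𝓝 w, T.pot (chartVec w') = ((T.chartPotential w' : ℝ) : EReal) := by
  filter_upwards [T.isOpen_regularLocus.eventually_mem hw] with w' hw'
  exact (EReal.coe_toReal (T.pot_lt_top (chartVec_ne_zero w')).ne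
    (T.pot_chartVec_ne_bot_of_continuousAt ((T.mem_regularLocus_iff w').1 hw').continuousAt)).symm

/-- **An admissible Lelong slope of the cone potential at a chart point bounds the chart
potential**: if `V ≤ γ log ‖z - (1, w₀)‖ + C` near `(1, w₀)` then
`V(1, w) ≤ γ log ‖w - w₀‖ + C` for `w ≠ w₀` near `w₀`. [folklore] -/
theorem eventually_pot_chartVec_le_log {w₀ : Fin N → ℂ} {γ : ℝ}
    (hγ : γ ∈ lelongSlopes T.pot (chartVec w₀)) :
    ∃ C : ℝ, ∀ᶠ w in 𝓝[≠] w₀,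
      T.pot (chartVec w) ≤ ((γ * Real.log ‖w - w₀‖ + C : ℝ) : EReal) := by
  obtain ⟨-, C, hC⟩ := hγ
  refine ⟨C, ?_⟩
  filter_upwards [(tendsto_chartVec_nhdsNE w₀).eventually hC] with w hw
  rwa [norm_chartVec_sub] at hw

/-- **Sub-mean-value inequality for the chart potential near a regular point**: for `w ∈ Reg(T)`,
every direction `ξ` and all small radii `r > 0`,
`g(w) ≤ (2π)⁻¹ ∫₀^{2π} g(w + r e^{iθ} ξ) dθ` (plurisubharmonicity of `V` along the complex line
`(1, w) + ℂ (0, ξ)`, read through `V(1, ·) = g` near `w`). [cite: HormanderSCV1973, Def. 2.6.1] -/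
theorem eventually_chartPotential_le_circleAverage {w : Fin N → ℂ} (hw : w ∈ T.regularLocus)
    (ξ : Fin N → ℂ) : ∀ᶠ r in 𝓝[>] (0 : ℝ),
      T.chartPotential w ≤ Real.circleAverage (fun τ : ℂ ↦ T.chartPotential (w + τ • ξ)) 0 r := by
  -- a ball around `w` of regular points where `V(1, ·) = g`
  obtain ⟨δ, hδ, hballδ⟩ : ∃ δ > 0, ∀ w', dist w' w < δ →
      T.pot (chartVec w') = ((T.chartPotential w' : ℝ) : EReal) ∧ w' ∈ T.regularLocus := by
    have := (T.eventually_pot_chartVec_eq_coe hw).and (T.isOpen_regularLocus.eventually_mem hw)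
    rw [Metric.eventually_nhds_iff] at this
    exact this
  have hr : ∀ᶠ r in 𝓝[>] (0 : ℝ), 0 < r ∧ r * ‖ξ‖ < δ := by
    have h2 : ∀ᶠ r in 𝓝 (0 : ℝ), r * ‖ξ‖ < δ := by
      have : Tendsto (fun r : ℝ ↦ r * ‖ξ‖) (𝓝 0) (𝓝 0) := by
        simpa using (show Continuous (fun r : ℝ ↦ r * ‖ξ‖) by fun_prop).tendsto (0 : ℝ)
      exact this.eventually (Iio_mem_nhds hδ)
    filter_upwards [self_mem_nhdsWithin, nhdsWithin_le_nhds h2] with r h1 h3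
    exact ⟨h1, h3⟩
  filter_upwards [hr] with r ⟨hr0, hrδ⟩
  -- points of the closed disc are in the ball
  have hdisc : ∀ τ : ℂ, ‖τ‖ ≤ r → dist (w + τ • ξ) w < δ := by
    intro τ hτ
    rw [dist_eq_norm, add_sub_cancel_left]
    calc ‖τ • ξ‖ ≤ ‖τ‖ * ‖ξ‖ := norm_smul_le τ ξ
      _ ≤ r * ‖ξ‖ := by gcongr
      _ < δ := hrδ
  -- plurisubharmonicity along the line `(1, w) + τ (0, ξ)`
  set v : Fin (N + 1) → ℂ := Fin.insertNth 0 (0 : ℂ) ξ with hv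
  have hpsh := T.isPlurisubharmonicOn_pot.le_circleMean (chartVec w) v hr0 (fun τ _ ↦ by
    rw [hv, ← chartVec_add_smul]; exact chartVec_ne_zero _)
  -- rewrite both sides through `g`
  have hcenter : T.pot (chartVec w) = ((T.chartPotential w : ℝ) : EReal) :=
    (hballδ w (by simp [hδ])).1
  set f : ℂ → ℝ := fun τ ↦ T.chartPotential (w + τ • ξ) with hf
  have hcirc : ∀ θ : ℝ, T.pot (chartVec w + circleMap 0 r θ • v) =
      ((f (circleMap 0 r θ) : ℝ) : EReal) := by
    intro θ
    rw [hv, ← chartVec_add_smul, hf]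
    exact (hballδ _ (hdisc _ (by simp [abs_of_pos hr0]))).1
  have hcont : ContinuousOn f (sphere (0 : ℂ) |r|) := by
    intro τ hτ
    have hτ' : ‖τ‖ ≤ r := by
      rw [mem_sphere_zero_iff_norm.1 hτ, abs_of_pos hr0]
    have hreg := (hballδ _ (hdisc τ hτ')).2
    have hcτ : ContinuousAt T.chartPotential (w + τ • ξ) :=
      ((T.mem_regularLocus_iff _).1 hreg).continuousAt
    have hcomp : ContinuousAt f τ :=
      ContinuousAt.comp (f := fun τ : ℂ ↦ w + τ • ξ) hcτ (by fun_prop)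
    exact hcomp.continuousWithinAt
  have hmean : circleMean (fun τ : ℂ ↦ T.pot (chartVec w + τ • v)) 0 r =
      ((Real.circleAverage f 0 r : ℝ) : EReal) := by
    rw [circleMean_congr (v := fun τ ↦ ((f τ : ℝ) : EReal)) fun θ _ ↦ hcirc θ]
    exact circleMean_coe_eq_circleAverage f 0 r hcont.circleIntegrable'
  rw [hcenter, hmean, EReal.coe_le_coe_iff] at hpsh
  exact hpsh

/-- **The Levi form of a closed positive `(1,1)`-current is positive semidefinite on its regular
locus**: for `w ∈ Reg(T)` (chart potential `g` of class `C²` at `w`), `(∂²g/∂w_p∂w̄_q)(w) ≥ 0`,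
i.e. `T = dd^c g ≥ 0` pointwise there. [cite: HormanderSCV1973, §2.6 (Levi form of psh functions)] -/
theorem posSemidef_leviMatrix_chartPotential {w : Fin N → ℂ} (hw : w ∈ T.regularLocus) :
    (leviMatrix T.chartPotential w).PosSemidef :=
  posSemidef_leviMatrix_of_contDiffAt hw fun ξ ↦
    (T.eventually_chartPotential_le_circleAverage hw ξ).frequently

/-- **The Monge–Ampère density of a current is non-negative on its regular locus**:
`heightDensity N g w = N! (2/π)ᴺ det(∂∂̄g)(w) ≥ 0` for `w ∈ Reg(T)`; in particular nothing is
truncated in `regularMass N = ∫⁻_{Reg} ENNReal.ofReal (heightDensity N g)`. [folklore] -/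
theorem heightDensity_chartPotential_nonneg {w : Fin N → ℂ} (hw : w ∈ T.regularLocus) :
    0 ≤ heightDensity N T.chartPotential w :=
  heightDensity_self_nonneg_of_posSemidef (T.posSemidef_leviMatrix_chartPotential hw)

/-- **Dimension zero.** On `ℙ⁰(ℂ)` (a point) every closed positive `(1,1)`-current has zero Lelong
number: its cone potential is `V(a) = V(v) + c log|a/v|` on `ℂ ∖ 0`, finite and continuous.
[folklore] -/
theorem lelongNumber_eq_zero_of_dim_zero (T : ClosedPositiveOneOneCurrent 0)
    (x : ℙ ℂ (Fin 1 → ℂ)) : T.lelongNumber x = 0 := by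
  rw [ClosedPositiveOneOneCurrent.lelongNumber]
  set v := x.rep with hv
  have hv0 : v ≠ 0 := x.rep_nonzero
  have hv00 : v 0 ≠ 0 := by
    intro h
    apply hv0
    funext i
    rw [Subsingleton.elim i 0, h]
    rfl
  have hy : ∀ y : Fin 1 → ℂ, y = (y 0 / v 0) • v := by
    intro y
    funext i
    rw [Subsingleton.elim i 0, Pi.smul_apply, smul_eq_mul, div_mul_cancel₀ _ hv00]
  have hya : ∀ y : Fin 1 → ℂ, y ≠ 0 → y 0 / v 0 ≠ 0 := by
    intro y hy0 h
    apply hy0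
    rw [hy y, h, zero_smul]
  -- `V v` is finite
  have hfin : T.pot v ≠ ⊥ := by
    intro hbot
    have hev : ∀ᶠ y in 𝓝 v, T.pot y = ⊥ := by
      filter_upwards [isOpen_ne.eventually_mem hv0] with y hy0
      have key := T.pot_smul (hya y hy0) hv0
      rw [← hy y] at key
      rw [key, hbot, EReal.bot_add]
    exact T.frequently_ne_bot v hv0 (hev.mono fun y h ↦ not_ne_iff.mpr h)
  -- `V = m + c log |y₀ / v₀|` near `v`, a continuous real function
  set m := (T.pot v).toReal with hm_def
  have hm : T.pot v = (m : EReal) := (EReal.coe_toReal (T.pot_lt_top hv0).ne hfin).symm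
  have key : ∀ᶠ y in 𝓝[≠] v,
      T.pot y = ((m + T.degree * Real.log ‖y 0 / v 0‖ : ℝ) : EReal) := by
    filter_upwards [nhdsWithin_le_nhds (isOpen_ne.eventually_mem hv0)] with y hy0
    have k := T.pot_smul (hya y hy0) hv0
    rw [← hy y] at k
    rw [k, hm, ← EReal.coe_add]
  have hcont : ContinuousAt (fun y : Fin 1 → ℂ ↦ m + T.degree * Real.log ‖y 0 / v 0‖) v := by
    have h1 : ‖v 0 / v 0‖ ≠ 0 := by simp [hv00]
    have hc0 : Continuous (fun y : Fin 1 → ℂ ↦ ‖y 0 / v 0‖) := by fun_prop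
    exact continuousAt_const.add (continuousAt_const.mul (hc0.continuousAt.log h1))
  exact lelongNumber_eq_zero_of_continuousAt hcont key

/-- The Guedj–Zeriahi fact in dimension `N = 0` (where its hypothesis `regularMass 0 = (deg T)⁰`
holds for every `T` and the conclusion is `lelongNumber_eq_zero_of_dim_zero`). [folklore] -/
theorem lelongNumber_eq_zero_of_regularMass_eq_dim_zero (T : ClosedPositiveOneOneCurrent 0)
    (_hdeg : 0 < T.degree) (_hmass : T.regularMass 0 = ENNReal.ofReal (T.degree ^ 0))
    (x : ℙ ℂ (Fin 1 → ℂ)) : T.lelongNumber x = 0 :=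
  lelongNumber_eq_zero_of_dim_zero T x

end ClosedPositiveOneOneCurrent

end Current

end Literature.Analysis.Pluripotential

end
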